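import Summits.ResolutionOfSingularities.ResolutionOfSingularities.Theorems.PurelyInseparableDim4NoDoubleRise
import HarnessLib
import HarnessLib.Audit.Tags

/-!
# Purely inseparable hypersurfaces `z^p + F` — NO DOUBLE RISE ALONG ZIGZAGS (`e = 1`), part 2:
# the class-(4,1) frame form [OURS · CANDIDATE · counted 0 · card I-9-2 of cell res-dim4-pi, hand proof PROOF-B]

Part 2 of idea-9 g2's `NoDoubleRise.lean` (05896a07ea8a032e), landed verbatim in two parts at its own `section`
seam (typ-2 g2; part 1 = `PurelyInseparableDim4NoDoubleRise.lean`, the model-level theorem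
`five_le_card_of_rise_rise` / `_add`). CLASS `(4,1)` (the cell's frame): two consecutive `Edge`s along centres
with `IsPermissibleCentre` ∧ `Perm2` at their sources, the shade constant at the `K`-points of each centre (or
just: no jump at the centre part of each edge's point), the first RISE:d ⇒ the second is NOT RISE:d
(`not_riseD_of_riseD_of_edges`, `shade_le_of_riseD_piecewise`).

HONEST SCOPE (as in part 1). For FIBRE points this is the `m = n + 2` case of Moh's `e = 1` stability, in the
tree for every number of variables (`CentreBlowup.shade_le_shade_add_one_along`); the content is the TRANSLATED
case. Special points of a centre (shade jump at `c`, (2) failing at `c`) are excluded per edge, exactly as in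
`JumpLedgerAlong`; `e = 1` only; stalls between the two rises are not covered; in `≥ 5` variables nothing is
claimed. Resolution of singularities in dimension ≥ 4 / characteristic `p` is NOT proved anywhere in this
programme; counted 0; AI formalisation, weaker than expert review.

bears_on: LADDER-RESOLUTION:D157-DOOR2 (res-dim4-pi · I-9-2).
[cite: HauserPerlega2019PRIMS, §3 Theorem (2), (6), (7), Comments (b), (d)]
[cite: Moh1987, Stability Theorem (p. 966)]
-/

set_option linter.dupNamespace false

noncomputable section

open MvPolynomial Finset

open scoped BigOperators

namespace Summit.ResolutionOfSingularities.ResolutionOfSingularities.Theorems.PIDim4.NoDoubleRise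

open Literature.AlgebraicGeometry.Resolution
open Literature.AlgebraicGeometry.Resolution.Hauser2010
open Literature.AlgebraicGeometry.Resolution.CentreBlowup
open KangarooLoss MohAlong JumpLedger

/-! ## 2. Class `(4,1)`: the cell's frame -/

section Frame

variable {K : Type} [Field K] [DecidableEq K] (p : ℕ) [hp : Fact p.Prime] [CharP K p]

/-- **No double rise, pointwise form.** Class `(4,1)`, `e = 1`: `s` clean (`F ≠ 0`, `x^r ∣ F`), a centre
`S₁ ∋ j₁` with `IsPermissibleCentre` ∧ `Perm2` at `s` and a chart point `b₁` (`b₁ j₁ = 0`) with no shade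
jump at its centre part `S₁.piecewise 0 b₁` and RISE:d; then a centre `S₂ ∋ j₂` with
`IsPermissibleCentre` ∧ `Perm2` at `s' := step p S₁ j₁ b₁ s` and a chart point `b₂` (`b₂ j₂ = 0`) with
no shade jump at `S₂.piecewise 0 b₂` ⇒ the second edge is NOT RISE:d.
[cite: HauserPerlega2019PRIMS, §3 Theorem (2), (6), (7), Comments (b), (d)] [cite: Moh1987, Stability Theorem (p. 966)] -/
theorem shade_le_of_riseD_piecewise {S₁ S₂ : Finset (Fin 4)} {j₁ j₂ : Fin 4} (hj₁ : j₁ ∈ S₁)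
    (hj₂ : j₂ ∈ S₂) (b₁ b₂ : Fin 4 → K) (hb₁j : b₁ j₁ = 0) (hb₂j : b₂ j₂ = 0) (s : State K)
    (hclean : deletePthPowers p s.F = s.F) (hF : s.F ≠ 0) (hr : ∀ d ∈ s.F.support, s.r ≤ d)
    (h1 : IsPermissibleCentre p S₁ s.F) (h2 : Perm2 S₁ s)
    (heq : CState.shade ⟨deletePthPowers p (PointBlowup.translate (S₁.piecewise (0 : Fin 4 → K) b₁) s.F),
        s.r.filter (fun i => S₁.piecewise (0 : Fin 4 → K) b₁ i = 0),
        s.exc.filter (fun i => S₁.piecewise (0 : Fin 4 → K) b₁ i = 0)⟩ = s.shade)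
    (hrise : RiseD s (CentreBlowup.step p S₁ j₁ b₁ s))
    (h1' : IsPermissibleCentre p S₂ (CentreBlowup.step p S₁ j₁ b₁ s).F)
    (h2' : Perm2 S₂ (CentreBlowup.step p S₁ j₁ b₁ s))
    (heq' : CState.shade ⟨deletePthPowers p (PointBlowup.translate (S₂.piecewise (0 : Fin 4 → K) b₂)
          (CentreBlowup.step p S₁ j₁ b₁ s).F),
        (CentreBlowup.step p S₁ j₁ b₁ s).r.filter (fun i => S₂.piecewise (0 : Fin 4 → K) b₂ i = 0),
        (CentreBlowup.step p S₁ j₁ b₁ s).exc.filter (fun i => S₂.piecewise (0 : Fin 4 → K) b₂ i = 0)⟩ =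
        (CentreBlowup.step p S₁ j₁ b₁ s).shade) :
    ¬ RiseD (CentreBlowup.step p S₁ j₁ b₁ s)
      (CentreBlowup.step p S₂ j₂ b₂ (CentreBlowup.step p S₁ j₁ b₁ s)) := by
  intro hrise₂
  have hq := (isPermissibleCentre_iff.mp h1).2
  have hq' := (isPermissibleCentre_iff.mp h1').2
  have hc₁ : ∀ i ∈ S₁, S₁.piecewise (0 : Fin 4 → K) b₁ i = 0 := fun i hi => by
    rw [Finset.piecewise, if_pos hi, Pi.zero_apply]
  have hb₁'j : S₁.piecewise b₁ (0 : Fin 4 → K) j₁ = 0 := by rw [Finset.piecewise, if_pos hj₁, hb₁j]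
  have hb₁' : ∀ i, i ∉ S₁ → S₁.piecewise b₁ (0 : Fin 4 → K) i = 0 := fun i hi => by
    rw [Finset.piecewise, if_neg hi, Pi.zero_apply]
  have hc₂ : ∀ i ∈ S₂, S₂.piecewise (0 : Fin 4 → K) b₂ i = 0 := fun i hi => by
    rw [Finset.piecewise, if_pos hi, Pi.zero_apply]
  have hb₂'j : S₂.piecewise b₂ (0 : Fin 4 → K) j₂ = 0 := by rw [Finset.piecewise, if_pos hj₂, hb₂j]
  have hb₂' : ∀ i, i ∉ S₂ → S₂.piecewise b₂ (0 : Fin 4 → K) i = 0 := fun i hi => by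
    rw [Finset.piecewise, if_neg hi, Pi.zero_apply]
  rw [← piecewise_add_piecewise S₁ b₁] at hrise h1' h2' hq' heq' hrise₂
  rw [← piecewise_add_piecewise S₂ b₂] at hrise₂
  have h5 := five_le_card_of_rise_rise_add p hj₁ hj₂ _ _ _ _ hb₁'j hb₁' hc₁ hb₂'j hb₂' hc₂ s hclean hF
    hr hq h2 heq hrise hq' h2' heq' hrise₂
  have h4 : S₁.card ≤ 4 := by
    have := Finset.card_le_univ S₁
    rwa [Fintype.card_fin] at this
  omega

/-- **No double rise along centres on which the shade is constant.**  Class `(4,1)`, `e = 1`: `s` a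
clean presented state (`F ≠ 0`, `x^r ∣ F`); `S₁` a coordinate centre with `IsPermissibleCentre` ∧
`Perm2` at `s` on whose `K`-points the shade of `s` is constant; an `Edge p S₁ s s'` with RISE:d; then
`S₂` a coordinate centre with `IsPermissibleCentre` ∧ `Perm2` at `s'` on whose `K`-points the shade of
`s'` is constant: NO `Edge p S₂ s' s''` is RISE:d.  For fibre replies this is Moh's `e = 1` stability
(`CentreBlowup.shade_le_shade_add_one_along`, every dimension); the content is the translated case.
The constancy clauses cannot be dropped (`PurelyInseparableDim4MohAlongSpecialPoint.lean`).
[cite: HauserPerlega2019PRIMS, §3 Theorem (2), (6), (7), Comments (b), (d)] [cite: Moh1987, Stability Theorem (p. 966)] -/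
theorem not_riseD_of_riseD_of_edges {S₁ S₂ : Finset (Fin 4)} (s s' s'' : State K)
    (hclean : deletePthPowers p s.F = s.F) (hF : s.F ≠ 0) (hr : ∀ d ∈ s.F.support, s.r ≤ d)
    (h1 : IsPermissibleCentre p S₁ s.F) (h2 : Perm2 S₁ s)
    (hconst : ∀ c : Fin 4 → K, (∀ i ∈ S₁, c i = 0) →
      CState.shade ⟨deletePthPowers p (PointBlowup.translate c s.F),
        s.r.filter (fun i => c i = 0), s.exc.filter (fun i => c i = 0)⟩ = s.shade)
    (hedge : Edge p S₁ s s') (hrise : RiseD s s')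
    (h1' : IsPermissibleCentre p S₂ s'.F) (h2' : Perm2 S₂ s')
    (hconst' : ∀ c : Fin 4 → K, (∀ i ∈ S₂, c i = 0) →
      CState.shade ⟨deletePthPowers p (PointBlowup.translate c s'.F),
        s'.r.filter (fun i => c i = 0), s'.exc.filter (fun i => c i = 0)⟩ = s'.shade)
    (hedge' : Edge p S₂ s' s'') : ¬ RiseD s' s'' := by
  obtain ⟨j₁, b₁, hj₁, hb₁j, -, -, rfl⟩ := hedge
  obtain ⟨j₂, b₂, hj₂, hb₂j, -, -, rfl⟩ := hedge'
  have hc₁ : ∀ i ∈ S₁, S₁.piecewise (0 : Fin 4 → K) b₁ i = 0 := fun i hi => by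
    rw [Finset.piecewise, if_pos hi, Pi.zero_apply]
  have hc₂ : ∀ i ∈ S₂, S₂.piecewise (0 : Fin 4 → K) b₂ i = 0 := fun i hi => by
    rw [Finset.piecewise, if_pos hi, Pi.zero_apply]
  exact shade_le_of_riseD_piecewise p hj₁ hj₂ b₁ b₂ hb₁j hb₂j s hclean hF hr h1 h2 (hconst _ hc₁)
    hrise h1' h2' (hconst' _ hc₂)

end Frame

end Summit.ResolutionOfSingularities.ResolutionOfSingularities.Theorems.PIDim4.NoDoubleRise

end
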